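import Summits.QuantumAdvantage.AdviceFreeQNC0.AffBells33ParityClass
import Summits.QuantumAdvantage.AdviceFreeQNC0.AffBells33FibreTargets

/-!
# AffBells33 — THE FIBRE DICHOTOMY, PROVED (Part IV of planner qa-qnc0-p1 g33's `FibreDichotomyProof33.lean`, with the `𝔽₄` instantiation of Part II)

Cell qa-qnc0, route DWalkThree (crux stmt-QuantumAdvantage-22907; rung (NP₁) `AffBells26.AffBellsPolyLoss3`).  AUTHORED AND PROVED BY THE
PLANNER SEAT qa-qnc0-p1 g33 (farm rc 0 / 0 sorry; memo ROUND-32); landed VERBATIM (one-line docstrings added) by qn-prover-3 g19, ask P-33a(3).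

§1 `𝔽₄ = GaloisField 2 2` has a primitive cube root of unity (`exists_omega_galoisField`); `parityClass_dichotomy` (hypothesis-free form of
`parityClass_dichotomy_of_omega`).  §2 Ring glue: the kline-fibre of an odd `x` is `{flipAt x S : S ⊆ coins, |S| even}` (forcing equations
`Fib19.apply_eq_of_kline`, free coins `Fib19.inKernel_flipAt_iff`, parity `Fib19.isOdd_flipAt_iff`), i.e. the parity class `H_0` of the coin
cube `{0,1}^Z` (`coinsOf`, `xOf`, `exists_xOf_eq`, `xOf_injective`); on it the active bells are affine MOD₃ tests of the flip vector
(`form_xOf`, via `AffBells28lit.form_flipAt`) and the ring relation is the parity of `#firing active bells + N + Z + pairs2` (`rel_xOf_iff`, via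
`AffBells26.targetFormula`).  Hence **`fibreDichotomy : FibreDichotomy`** with exponent `e = 6`, and the corollaries `polyLoss_of_exFib'`
((NP₁) ⟸ `ExFib`), `polyLoss_of_wide'` ((NP₁) ⟸ `WideNonExact`), `nonExact_le_losers'`.
WHAT THIS IS NOT: no crux closed; `WideNonExact` is a conjecture; separation NOT moved.
-/

noncomputable section

open Classical

namespace Summit.QuantumAdvantage.AdviceFreeQNC0

namespace AffBells33

open Finset Literature.Computability.QuantumComplexity Literature.Computability.QuantumComplexity.RingHLF
open AffBells23 AffBells26 Fib19 AffBells29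

/-! ### §1 Instantiation over `𝔽₄ = GaloisField 2 2` -/

section GF4

/-- `𝔽₄` contains a primitive cube root of unity. -/
theorem exists_omega_galoisField : ∃ ω : GaloisField 2 2, ω ^ 2 + ω + 1 = 0 := by
  classical
  haveI : Fintype (GaloisField 2 2) := Fintype.ofFinite _
  have hcard : Fintype.card (GaloisField 2 2) = 4 := by
    rw [Fintype.card_eq_nat_card, GaloisField.card 2 2 (by norm_num)]; norm_num
  -- some element outside {0,1}
  obtain ⟨c, hc0, hc1⟩ : ∃ c : GaloisField 2 2, c ≠ 0 ∧ c ≠ 1 := by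
    by_contra hall
    push Not at hall
    have hsub : (Finset.univ : Finset (GaloisField 2 2)) ⊆ {0, 1} := by
      intro c _
      by_cases h : c = 0
      · simp [h]
      · simp [hall c h]
    have := Finset.card_le_card hsub
    rw [Finset.card_univ, hcard] at this
    exact absurd (this.trans Finset.card_le_two) (by norm_num)
  refine ⟨c, ?_⟩
  have h4 : c ^ 4 = c := by
    have h := FiniteField.pow_card c
    rwa [hcard] at h
  -- c (c - 1) (c² + c + 1) = c⁴ - c = 0
  have hfac : c * (c - 1) * (c ^ 2 + c + 1) = c ^ 4 - c := by ring
  rw [h4, sub_self] at hfac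
  rcases mul_eq_zero.1 hfac with h | h
  · rcases mul_eq_zero.1 h with h | h
    · exact absurd h hc0
    · exact absurd (sub_eq_zero.1 h) hc1
  · exact h

/-- **AFFINE-TEST PARITY-CLASS DICHOTOMY (𝔽₄ instantiated, hypothesis-free).**  For `K` affine MOD₃ tests on `{0,1}^Z`, a constant `τ`
and a parity `p`: either `τ + #passed` is even on the whole parity class `H_p`, or it is odd on `≥ 2^Z / (4((2K+1)(Z+1))²)` points of `H_p`. -/
theorem parityClass_dichotomy {Z K : ℕ} (P : Fin K → Fin Z → ZMod 3) (r : Fin K → ZMod 3) (τ p : ℕ) :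
    (∀ y : Fin Z → Bool, onesCard y % 2 = p % 2 → testCount P r τ y % 2 = 0) ∨
      2 ^ Z ≤ 4 * ((2 * K + 1) * (Z + 1)) ^ 2 *
        (univ.filter fun y : Fin Z → Bool => onesCard y % 2 = p % 2 ∧ testCount P r τ y % 2 = 1).card := by
  classical
  obtain ⟨ω, hω⟩ := exists_omega_galoisField
  haveI : Fact (Nat.Prime 2) := ⟨Nat.prime_two⟩
  exact parityClass_dichotomy_of_omega (F := GaloisField 2 2) hω P r τ p

end GF4

variable {N : ℕ}

/-! ### §2 The fibre dictionary and the dichotomy -/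

section FibreGlue

open AffBells28 AffBells28lit

/-- the coins of `x`: the zeros of its kernel line. -/
def coinsOf (x : Fin N → Bool) : Finset (Fin N) := univ.filter fun i => kline x i = false

/-- the number of coins is the number of zeros of the kernel line. -/
theorem card_coinsOf (x : Fin N → Bool) : (coinsOf x).card = zeros (kline x) := rfl

/-- there are at most `N` coins. -/
theorem card_coinsOf_le (x : Fin N → Bool) : (coinsOf x).card ≤ N := by
  unfold coinsOf
  exact (card_filter_le _ _).trans (by rw [card_univ, Fintype.card_fin])

/-- enumeration of the coins. -/
def coinEmb (x : Fin N → Bool) (t : Fin (coinsOf x).card) : Fin N := ((coinsOf x).equivFin.symm t).1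

/-- `coinEmb` lands in the coins. -/
theorem coinEmb_mem (x : Fin N → Bool) (t : Fin (coinsOf x).card) : coinEmb x t ∈ coinsOf x :=
  ((coinsOf x).equivFin.symm t).2

/-- `coinEmb` is injective. -/
theorem coinEmb_injective (x : Fin N → Bool) : Function.Injective (coinEmb x) :=
  fun _ _ h => (coinsOf x).equivFin.symm.injective (Subtype.ext h)

/-- every coin is in the range of `coinEmb`. -/
theorem exists_coinEmb_eq (x : Fin N → Bool) {i : Fin N} (hi : i ∈ coinsOf x) : ∃ t, coinEmb x t = i :=
  ⟨(coinsOf x).equivFin ⟨i, hi⟩, by simp [coinEmb]⟩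

/-- the set of coins flipped according to `y ∈ {0,1}^Z`. -/
def flipSetOf (x : Fin N → Bool) (y : Fin (coinsOf x).card → Bool) : Finset (Fin N) :=
  (univ.filter fun t => y t = true).map ⟨coinEmb x, coinEmb_injective x⟩

/-- the flip set consists of coins. -/
theorem flipSetOf_subset (x : Fin N → Bool) (y : Fin (coinsOf x).card → Bool) : flipSetOf x y ⊆ coinsOf x := by
  intro i hi
  obtain ⟨t, -, rfl⟩ := mem_map.1 hi
  exact coinEmb_mem x t

/-- the flip set has `onesCard y` elements. -/
theorem card_flipSetOf (x : Fin N → Bool) (y : Fin (coinsOf x).card → Bool) : (flipSetOf x y).card = onesCard y := by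
  unfold flipSetOf onesCard
  rw [card_map]

/-- membership of a coin in the flip set is read off `y`. -/
theorem coinEmb_mem_flipSetOf (x : Fin N → Bool) (y : Fin (coinsOf x).card → Bool) (t : Fin (coinsOf x).card) :
    coinEmb x t ∈ flipSetOf x y ↔ y t = true := by
  unfold flipSetOf
  rw [mem_map]
  constructor
  · rintro ⟨t', ht', h⟩
    have htt : t' = t := coinEmb_injective x h
    subst htt
    exact (mem_filter.1 ht').2
  · intro h
    exact ⟨t, mem_filter.2 ⟨mem_univ _, h⟩, rfl⟩

/-- the fibre point encoded by `y`: flip the coins of `flipSetOf x y`. -/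
def xOf (x : Fin N → Bool) (y : Fin (coinsOf x).card → Bool) : Fin N → Bool := flipAt x (flipSetOf x y)

/-- flipping an even number of coins keeps the input odd. -/
theorem isOdd_xOf {x : Fin N → Bool} (hodd : IsOdd x) {y : Fin (coinsOf x).card → Bool} (hy : onesCard y % 2 = 0) :
    IsOdd (xOf x y) :=
  (isOdd_flipAt_of_even x _ (by rw [card_flipSetOf]; exact hy)).2 hodd

/-- flipping coins keeps the kernel line. -/
theorem kline_xOf (hN : 3 ≤ N) {x : Fin N → Bool} (hodd : IsOdd x) {y : Fin (coinsOf x).card → Bool} (hy : onesCard y % 2 = 0) :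
    kline (xOf x y) = kline x :=
  (kline_eq_iff_inKernel hN _ (isOdd_xOf hodd hy) (kline_ne_zero hN x hodd)).2
    ((inKernel_flipAt_iff x (kline x) _ fun _ hi => (mem_filter.1 (flipSetOf_subset x y hi)).2).2 (kline_inKernel hN x hodd))

/-- the active rows as affine tests on the coin cube (inactive rows become the impossible test `0 = 1`). -/
def testMat (β : Fin N → Fin N → ZMod 3) (x : Fin N → Bool) : Fin N → Fin (coinsOf x).card → ZMod 3 :=
  fun b t => if kline x b = true then sdelta β x b (coinEmb x t) else 0

/-- right-hand sides of the tests. -/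
def testRhs (β : Fin N → Fin N → ZMod 3) (c : Fin N → ZMod 3) (x : Fin N → Bool) : Fin N → ZMod 3 :=
  fun b => if kline x b = true then c b - form β x b else 1

/-- the constant `N + Z + pairs2` of the target formula. -/
def tauOf (x : Fin N → Bool) : ℕ := N + zeros (kline x) + pairs2 (kline x)

/-- the linear forms of a flipped input. -/
theorem form_xOf (β : Fin N → Fin N → ZMod 3) (x : Fin N → Bool) (y : Fin (coinsOf x).card → Bool) (b : Fin N) :
    form β (xOf x y) b = form β x b + ∑ t, if y t = true then sdelta β x b (coinEmb x t) else 0 := by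
  unfold xOf
  rw [AffBells28lit.form_flipAt]
  congr 1
  unfold flipSetOf
  rw [sum_map, sum_filter]
  rfl

/-- passed tests = active positions where the bell fires correctly. -/
theorem passed_eq_activeOnes (hN : 3 ≤ N) {β : Fin N → Fin N → ZMod 3} {c : Fin N → ZMod 3} {x : Fin N → Bool} (hodd : IsOdd x)
    {y : Fin (coinsOf x).card → Bool} (hy : onesCard y % 2 = 0) :
    (univ.filter fun b => (∑ t, if y t then testMat β x b t else 0) = testRhs β c x b).card =
      activeOnes (xOf x y) (affBell β c (xOf x y)) := by
  unfold activeOnes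
  congr 1
  ext b
  simp only [mem_filter, mem_univ, true_and, kline_xOf hN hodd hy]
  by_cases hb : kline x b = true
  · simp only [testMat, testRhs, hb, ↓reduceIte, true_and]
    rw [affBell_eq_true_iff, form_xOf, eq_sub_iff_add_eq, add_comm]
  · have hb' : kline x b = false := by simpa using hb
    have hl : (∑ t, if y t = true then testMat β x b t else 0) = 0 :=
      sum_eq_zero fun t _ => by unfold testMat; rw [hb']; simp
    have hr : testRhs β c x b = 1 := by unfold testRhs; rw [hb']; simp
    rw [hl, hr]
    constructor
    · intro h; exact absurd h (by decide)
    · rintro ⟨h, -⟩; exact absurd h hb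

/-- the ring relation on the fibre in test coordinates (`targetFormula`). -/
theorem rel_xOf_iff (hN : 3 ≤ N) {β : Fin N → Fin N → ZMod 3} {c : Fin N → ZMod 3} {x : Fin N → Bool} (hodd : IsOdd x)
    {y : Fin (coinsOf x).card → Bool} (hy : onesCard y % 2 = 0) :
    Rel (xOf x y) (affBell β c (xOf x y)) ↔ testCount (testMat β x) (testRhs β c x) (tauOf x) y % 2 = 0 := by
  rw [targetFormula N hN _ (isOdd_xOf hodd hy), testCount, passed_eq_activeOnes hN hodd hy, kline_xOf hN hodd hy, tauOf]
  constructor <;> intro h <;> omega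

/-- the set of bits in which `x'` differs from `x`. -/
def diffSet (x x' : Fin N → Bool) : Finset (Fin N) := univ.filter fun i => x' i ≠ x i

/-- flipping the difference set moves `x` to `x'`. -/
theorem flipAt_diffSet (x x' : Fin N → Bool) : flipAt x (diffSet x x') = x' := by
  funext i
  by_cases h : x' i = x i
  · rw [flipAt_apply_of_not_mem (by simp [diffSet, h]), h]
  · rw [flipAt_apply_of_mem (by simp [diffSet, h])]
    revert h
    cases x i <;> cases x' i <;> decide

/-- two odd inputs with the same kernel line differ only on coins. -/
theorem diffSet_subset_coinsOf (hN : 3 ≤ N) {x x' : Fin N → Bool} (hodd : IsOdd x) (hodd' : IsOdd x') (hk : kline x' = kline x) :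
    diffSet x x' ⊆ coinsOf x := by
  intro i hi
  have hne : x' i ≠ x i := (mem_filter.1 hi).2
  refine mem_filter.2 ⟨mem_univ _, ?_⟩
  by_contra hJ
  rw [Bool.not_eq_false] at hJ
  have h1 := apply_eq_of_kline hN x hodd i hJ
  have h2 := apply_eq_of_kline hN x' hodd' i (by rw [hk]; exact hJ)
  rw [hk] at h2
  exact hne (h2.trans h1.symm)

/-- two odd inputs differ in an even number of bits. -/
theorem card_diffSet_mod_two {x x' : Fin N → Bool} (hodd : IsOdd x) (hodd' : IsOdd x') : (diffSet x x').card % 2 = 0 := by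
  have h := isOdd_flipAt_iff x (diffSet x x')
  rw [flipAt_diffSet] at h
  have h1 := (isOdd_iff x).1 hodd
  have h2 := h.1 hodd'
  omega

/-- every point of the fibre is an `xOf x y` with `y` in the parity class `H_0`. -/
theorem exists_xOf_eq (hN : 3 ≤ N) {x x' : Fin N → Bool} (hodd : IsOdd x) (hodd' : IsOdd x') (hk : kline x' = kline x) :
    ∃ y : Fin (coinsOf x).card → Bool, onesCard y % 2 = 0 ∧ xOf x y = x' := by
  have hS : flipSetOf x (fun t => decide (coinEmb x t ∈ diffSet x x')) = diffSet x x' := by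
    ext i
    constructor
    · intro hi
      obtain ⟨t, ht, rfl⟩ := mem_map.1 hi
      have h := (mem_filter.1 ht).2
      simpa using h
    · intro hi
      obtain ⟨t, rfl⟩ := exists_coinEmb_eq x (diffSet_subset_coinsOf hN hodd hodd' hk hi)
      exact (coinEmb_mem_flipSetOf x _ t).2 (by simpa using hi)
  refine ⟨fun t => decide (coinEmb x t ∈ diffSet x x'), ?_, ?_⟩
  · rw [← card_flipSetOf, hS]
    exact card_diffSet_mod_two hodd hodd'
  · unfold xOf
    rw [hS, flipAt_diffSet]

/-- the fibre has at most `2^Z` elements. -/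
theorem card_fibre_le_two_pow (hN : 3 ≤ N) {x : Fin N → Bool} (hodd : IsOdd x) : (fibre x).card ≤ 2 ^ (coinsOf x).card := by
  rw [← card_powerset]
  refine card_le_card_of_injOn (diffSet x) (fun x' hx' => ?_) (fun x₁ _ x₂ _ h => ?_)
  · have h := (mem_filter.1 (mem_coe.1 hx')).2
    exact mem_coe.2 (mem_powerset.2 (diffSet_subset_coinsOf hN hodd h.1 h.2))
  · rw [← flipAt_diffSet x x₁, h, flipAt_diffSet]

/-- `xor a` is injective. -/
theorem xor_right_cancel' {a b₁ b₂ : Bool} (h : xor a b₁ = xor a b₂) : b₁ = b₂ := by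
  cases a <;> cases b₁ <;> cases b₂ <;> simp_all

/-- `xOf x` is injective. -/
theorem xOf_injective (x : Fin N → Bool) : Function.Injective (xOf x) := by
  intro y₁ y₂ h
  funext t
  have hi := congrFun h (coinEmb x t)
  unfold xOf flipAt at hi
  have k := xor_right_cancel' hi
  have k' : coinEmb x t ∈ flipSetOf x y₁ ↔ coinEmb x t ∈ flipSetOf x y₂ := by simpa using k
  rw [coinEmb_mem_flipSetOf, coinEmb_mem_flipSetOf] at k'
  exact Bool.eq_iff_iff.2 k'

/-- **THE FIBRE DICHOTOMY (PROVED, `e = 6`).**  Every kline-fibre of an affine MOD₃ bell strategy is EXACT-WIN or has at least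
`|fibre| / (N+1)^6` losers. -/
theorem fibreDichotomy : FibreDichotomy := by
  refine ⟨6, fun N hN β c x hodd => ?_⟩
  rcases parityClass_dichotomy (testMat β x) (testRhs β c x) (tauOf x) 0 with hall | hbig
  · left
    intro x' hodd' hk
    obtain ⟨y, hy, rfl⟩ := exists_xOf_eq hN hodd hodd' hk
    exact (rel_xOf_iff hN hodd hy).2 (hall y (by rw [Nat.zero_mod]; exact hy))
  · right
    have hF := card_fibre_le_two_pow hN hodd
    have hZ := card_coinsOf_le x
    have hs : 4 * ((2 * N + 1) * ((coinsOf x).card + 1)) ^ 2 ≤ (N + 1) ^ 6 := by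
      have h1 : (2 * N + 1) * ((coinsOf x).card + 1) ≤ 2 * (N + 1) ^ 2 := by nlinarith [hZ]
      have h2 : 16 ≤ (N + 1) ^ 2 := by nlinarith [hN]
      calc 4 * ((2 * N + 1) * ((coinsOf x).card + 1)) ^ 2 ≤ 4 * (2 * (N + 1) ^ 2) ^ 2 :=
            Nat.mul_le_mul_left _ (Nat.pow_le_pow_left h1 2)
        _ = 16 * (N + 1) ^ 4 := by ring
        _ ≤ (N + 1) ^ 2 * (N + 1) ^ 4 := Nat.mul_le_mul_right _ h2
        _ = (N + 1) ^ 6 := by ring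
    refine hF.trans (hbig.trans (Nat.mul_le_mul hs ?_))
    refine card_le_card_of_injOn (xOf x) (fun y hy => ?_) (fun y₁ _ y₂ _ h => xOf_injective x h)
    have hy' := (mem_filter.1 (mem_coe.1 hy)).2
    have hpar : onesCard y % 2 = 0 := by have := hy'.1; omega
    refine mem_coe.2 (mem_filter.2 ⟨mem_univ _, isOdd_xOf hodd hpar, kline_xOf hN hodd hpar, fun hrel => ?_⟩)
    have := (rel_xOf_iff hN hodd hpar).1 hrel
    omega

/-- **(NP₁) ⟸ EXFIB** — with the fibre dichotomy proved, the rung follows from `ExFib` alone. -/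
theorem polyLoss_of_exFib' (hE : ExFib) : AffBellsPolyLoss3 := polyLoss_of_exFib fibreDichotomy hE

/-- **(NP₁) ⟸ (W)** — and from the single wide-row crux `WideNonExact` alone. -/
theorem polyLoss_of_wide' (hW : WideNonExact) : AffBellsPolyLoss3 := polyLoss_of_wide fibreDichotomy hW

/-- the unconditional corollary: the non-exact odd inputs are at most `(N+1)^{e}` times the losers (`e = 12` from `e = 6`). -/
theorem nonExact_le_losers' : ∃ e : ℕ, ∀ N : ℕ, 3 ≤ N → ∀ (β : Fin N → Fin N → ZMod 3) (c : Fin N → ZMod 3),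
    (nonExact β c).card ≤ (N + 1) ^ e * (losers β c).card := nonExact_le_losers fibreDichotomy

end FibreGlue

end AffBells33

end Summit.QuantumAdvantage.AdviceFreeQNC0
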